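import Summits.QuantumFields.YangMills.Theorems.FradkinShenkerFlowPoincareToClusteringDefs

/-!
# Geometry of the link neighbourhood and cyclic time distances (support of `PoincareToClustering`)

Route `FradkinShenkerFlow` of `YangMills`, support item `stmt-QuantumFields-9444`. Pure
combinatorics of the discrete torus `(ℤ/L)^d` used by the finite-speed-of-propagation argument:

* membership lemmas for `linkNbhd` (file `…Defs`), the volume-uniform bound
  `|linkNbhd ℓ| ≤ (d+1)(d+d²)` and the SYMMETRY `linkNbhd_symm`;
* neighbouring links have time coordinates differing by `0, ±1`
  (`exists_timeCoord_eq_add_of_mem_linkNbhd`), hence cyclic time distances `tdist` differing by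
  at most one (`tdist_le_of_mem_linkNbhd`); the cyclic norm of an integer class is at most its
  absolute value (`natAbs_valMinAbs_intCast_le`).

References: F. Martinelli, LNM 1717 (1999), §3 (finite-range interactions on `ℤ^d`).
-/

noncomputable section

open MeasureTheory ProbabilityTheory
open Literature.MathematicalPhysics.QuantumFieldTheory

namespace Summit.QuantumFields.YangMills.Theorems.PoincareClustering

section Geometry

variable {d L : ℕ}

/-! ### The link neighbourhood -/

/-- Links based at a shadow site are in the link neighbourhood. [folklore] -/
theorem mem_linkNbhd_base {ℓ : Edge d L} {y : Site d L}
    (hy : y ∈ edgeShadow ({ℓ} : Finset (Edge d L))) (i : Fin d) : (y, i) ∈ linkNbhd ℓ :=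
  Finset.mem_biUnion.2 ⟨y, hy, Finset.mem_union_left _
    (Finset.mem_image.2 ⟨i, Finset.mem_univ _, rfl⟩)⟩

/-- Links based at a forward neighbour of a shadow site are in the link neighbourhood. [folklore] -/
theorem mem_linkNbhd_shift {ℓ : Edge d L} {y : Site d L}
    (hy : y ∈ edgeShadow ({ℓ} : Finset (Edge d L))) (i j : Fin d) :
    (y.shift i, j) ∈ linkNbhd ℓ :=
  Finset.mem_biUnion.2 ⟨y, hy, Finset.mem_union_right _
    (Finset.mem_image.2 ⟨(i, j), Finset.mem_univ _, rfl⟩)⟩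

/-- The link neighbourhood has at most `(d+1)(d+d²)` links. [folklore] -/
theorem card_linkNbhd_le (ℓ : Edge d L) : (linkNbhd ℓ).card ≤ (d + 1) * (d + d * d) := by
  unfold linkNbhd
  calc _ ≤ ∑ y ∈ edgeShadow ({ℓ} : Finset (Edge d L)),
        ((Finset.univ.image fun i : Fin d => (y, i)) ∪
          (Finset.univ.image fun p : Fin d × Fin d => (y.shift p.1, p.2))).card :=
        Finset.card_biUnion_le
    _ ≤ ∑ _y ∈ edgeShadow ({ℓ} : Finset (Edge d L)), (d + d * d) :=
        Finset.sum_le_sum fun y _ => (Finset.card_union_le _ _).trans (add_le_add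
          (Finset.card_image_le.trans (by rw [Finset.card_univ, Fintype.card_fin]))
          (Finset.card_image_le.trans (by
            rw [Finset.card_univ, Fintype.card_prod, Fintype.card_fin])))
    _ = (edgeShadow ({ℓ} : Finset (Edge d L))).card * (d + d * d) := by
        rw [Finset.sum_const, smul_eq_mul]
    _ ≤ (d + 1) * (d + d * d) := by
        refine Nat.mul_le_mul_right _ ?_
        simpa only [Finset.card_singleton, one_mul] using
          card_edgeShadow_le ({ℓ} : Finset (Edge d L))

/-- The shadow of a single link: its base point and the backward neighbours of the base point.
[folklore] -/
theorem mem_edgeShadow_singleton_iff {ℓ : Edge d L} {y : Site d L} :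
    y ∈ edgeShadow ({ℓ} : Finset (Edge d L)) ↔ y = ℓ.1 ∨ ∃ m : Fin d, y = ℓ.1 - Pi.single m 1 := by
  unfold edgeShadow
  simp only [Finset.mem_union, Finset.mem_image, Finset.mem_singleton, Finset.mem_product,
    Finset.mem_univ, and_true]
  constructor
  · rintro (⟨e, rfl, rfl⟩ | ⟨q, hq, rfl⟩)
    · exact Or.inl rfl
    · exact Or.inr ⟨q.2, by rw [hq]⟩
  · rintro (rfl | ⟨m, rfl⟩)
    · exact Or.inl ⟨ℓ, rfl, rfl⟩
    · exact Or.inr ⟨(ℓ, m), rfl, rfl⟩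

/-- Membership in the link neighbourhood: based at a shadow site or at a forward neighbour of a
shadow site. [folklore] -/
theorem mem_linkNbhd_iff {ℓ ℓ' : Edge d L} :
    ℓ' ∈ linkNbhd ℓ ↔ ∃ y ∈ edgeShadow ({ℓ} : Finset (Edge d L)),
      ℓ'.1 = y ∨ ∃ k : Fin d, ℓ'.1 = y.shift k := by
  unfold linkNbhd
  simp only [Finset.mem_biUnion, Finset.mem_union, Finset.mem_image, Finset.mem_univ, true_and]
  constructor
  · rintro ⟨y, hy, (⟨i, hi⟩ | ⟨p, hp⟩)⟩
    · exact ⟨y, hy, Or.inl (by rw [← hi])⟩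
    · exact ⟨y, hy, Or.inr ⟨p.1, by rw [← hp]⟩⟩
  · rintro ⟨y, hy, (h | ⟨k, h⟩)⟩
    · exact ⟨y, hy, Or.inl ⟨ℓ'.2, Prod.ext h.symm rfl⟩⟩
    · exact ⟨y, hy, Or.inr ⟨(k, ℓ'.2), Prod.ext h.symm rfl⟩⟩

/-- Membership in the link neighbourhood in terms of base points: `ℓ'.1 − ℓ.1` is `0`, `−e_m`,
`e_k` or `e_k − e_m`. [folklore] -/
theorem mem_linkNbhd_iff' {ℓ ℓ' : Edge d L} :
    ℓ' ∈ linkNbhd ℓ ↔ ℓ'.1 = ℓ.1 ∨ (∃ m : Fin d, ℓ'.1 = ℓ.1 - Pi.single m 1) ∨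
      (∃ k : Fin d, ℓ'.1 = ℓ.1 + Pi.single k 1) ∨
      ∃ m k : Fin d, ℓ'.1 = ℓ.1 - Pi.single m 1 + Pi.single k 1 := by
  rw [mem_linkNbhd_iff]
  simp only [mem_edgeShadow_singleton_iff, Site.shift]
  constructor
  · rintro ⟨y, (rfl | ⟨m, rfl⟩), (h | ⟨k, h⟩)⟩
    · exact Or.inl h
    · exact Or.inr (Or.inr (Or.inl ⟨k, h⟩))
    · exact Or.inr (Or.inl ⟨m, h⟩)
    · exact Or.inr (Or.inr (Or.inr ⟨m, k, h⟩))
  · rintro (h | ⟨m, h⟩ | ⟨k, h⟩ | ⟨m, k, h⟩)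
    · exact ⟨ℓ.1, Or.inl rfl, Or.inl h⟩
    · exact ⟨ℓ.1 - Pi.single m 1, Or.inr ⟨m, rfl⟩, Or.inl h⟩
    · exact ⟨ℓ.1, Or.inl rfl, Or.inr ⟨k, h⟩⟩
    · exact ⟨ℓ.1 - Pi.single m 1, Or.inr ⟨m, rfl⟩, Or.inr ⟨k, h⟩⟩

/-- **The link neighbourhood is a symmetric relation.** [folklore] -/
theorem linkNbhd_symm {ℓ ℓ' : Edge d L} (h : ℓ' ∈ linkNbhd ℓ) : ℓ ∈ linkNbhd ℓ' := by
  rw [mem_linkNbhd_iff'] at h ⊢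
  rcases h with h | ⟨m, h⟩ | ⟨k, h⟩ | ⟨m, k, h⟩
  · exact Or.inl h.symm
  · exact Or.inr (Or.inr (Or.inl ⟨m, by rw [h, sub_add_cancel]⟩))
  · exact Or.inr (Or.inl ⟨k, by rw [h, add_sub_cancel_right]⟩)
  · exact Or.inr (Or.inr (Or.inr ⟨k, m, by rw [h]; abel⟩))

variable [NeZero d]

/-- The time coordinate (coordinate `0`) of `Pi.single i 1` is the integer `[i = 0]`. [folklore] -/
theorem single_apply_zero_eq_intCast (i : Fin d) :
    (Pi.single i (1 : ZMod L) : Site d L) 0 = ((if i = 0 then (1 : ℤ) else 0 : ℤ) : ZMod L) := by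
  rw [Pi.single_apply]
  by_cases h : i = 0
  · subst h; simp
  · simp [h, Ne.symm h]

/-- **Neighbouring links have time coordinates differing by `0` or `±1`.** [folklore] -/
theorem exists_timeCoord_eq_add_of_mem_linkNbhd {ℓ ℓ' : Edge d L} (h : ℓ' ∈ linkNbhd ℓ) :
    ∃ ε : ℤ, ε.natAbs ≤ 1 ∧ ℓ'.1 0 = ℓ.1 0 + (ε : ZMod L) := by
  rw [mem_linkNbhd_iff'] at h
  rcases h with h | ⟨m, h⟩ | ⟨k, h⟩ | ⟨m, k, h⟩
  · exact ⟨0, by simp, by rw [h]; simp⟩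
  · refine ⟨-(if m = 0 then (1 : ℤ) else 0), by split_ifs <;> simp, ?_⟩
    rw [h, Pi.sub_apply, single_apply_zero_eq_intCast, Int.cast_neg, sub_eq_add_neg]
  · refine ⟨if k = 0 then (1 : ℤ) else 0, by split_ifs <;> simp, ?_⟩
    rw [h, Pi.add_apply, single_apply_zero_eq_intCast]
  · refine ⟨(if k = 0 then (1 : ℤ) else 0) - (if m = 0 then (1 : ℤ) else 0),
      by split_ifs <;> simp, ?_⟩
    rw [h, Pi.add_apply, Pi.sub_apply, single_apply_zero_eq_intCast, single_apply_zero_eq_intCast,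
      Int.cast_sub]
    abel

/-! ### Cyclic time distances -/

omit [NeZero d] in
/-- The cyclic norm of the class of an integer is at most its absolute value. [folklore] -/
theorem natAbs_valMinAbs_intCast_le [NeZero L] (k : ℤ) :
    ((k : ZMod L).valMinAbs).natAbs ≤ k.natAbs :=
  ZMod.natAbs_min_of_le_div_two L _ _ (ZMod.coe_valMinAbs _) (ZMod.natAbs_valMinAbs_le _)

omit [NeZero d] in
/-- Adding a class of cyclic norm at most one changes the cyclic norm by at most one. [folklore] -/
theorem natAbs_valMinAbs_add_le_succ (a e : ZMod L) (he : (e.valMinAbs).natAbs ≤ 1) :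
    ((a + e).valMinAbs).natAbs ≤ (a.valMinAbs).natAbs + 1 :=
  (ZMod.natAbs_valMinAbs_add_le a e).trans ((Int.natAbs_add_le _ _).trans
    (Nat.add_le_add_left he _))

/-- **Neighbouring links have cyclic time distances differing by at most one.** [folklore] -/
theorem tdist_le_of_mem_linkNbhd [NeZero L] (c : ZMod L) {ℓ ℓ' : Edge d L}
    (h : ℓ' ∈ linkNbhd ℓ) : tdist c ℓ' ≤ tdist c ℓ + 1 ∧ tdist c ℓ ≤ tdist c ℓ' + 1 := by
  obtain ⟨ε, hε, hε'⟩ := exists_timeCoord_eq_add_of_mem_linkNbhd h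
  have h1 : ((ε : ZMod L).valMinAbs).natAbs ≤ 1 := (natAbs_valMinAbs_intCast_le ε).trans hε
  have h2 : (((-ε : ℤ) : ZMod L).valMinAbs).natAbs ≤ 1 :=
    (natAbs_valMinAbs_intCast_le (-ε)).trans (by rwa [Int.natAbs_neg])
  unfold tdist
  constructor
  · have : ℓ'.1 0 - c = (ℓ.1 0 - c) + (ε : ZMod L) := by rw [hε']; ring
    rw [this]
    exact natAbs_valMinAbs_add_le_succ _ _ h1
  · have : ℓ.1 0 - c = (ℓ'.1 0 - c) + ((-ε : ℤ) : ZMod L) := by rw [hε', Int.cast_neg]; ring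
    rw [this]
    exact natAbs_valMinAbs_add_le_succ _ _ h2

end Geometry

end Summit.QuantumFields.YangMills.Theorems.PoincareClustering

end
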